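import Summits.HodgeConjecture.HodgeConjecture.Theses.PeriodDeficiency
import Summits.HodgeConjecture.HodgeConjecture.Theorems.PeriodDeficiencyQbarGenericIsHodgeGenericStubMtRankAtBounded
import Summits.HodgeConjecture.HodgeConjecture.Theorems.PeriodDeficiencyQbarGenericIsHodgeGenericStubIrredClosedHasMaximal
import Summits.HodgeConjecture.HodgeConjecture.Theorems.PeriodDeficiencyQbarGenericIsHodgeGenericStubCountableOrbitDefinedOverQbar
import Summits.HodgeConjecture.HodgeConjecture.Theorems.PeriodDeficiencyQbarGenericIsHodgeGenericStubConjIrredClosed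
import Literature.AlgebraicGeometry.HodgeTheory.AlgebraicityLocus
import Literature.AlgebraicGeometry.HodgeTheory.ConjugateComplexPoints
import Literature.NumberTheory.Transcendental.AnalytificationProjProofs
import HarnessLib

/-!
# Crux `QbarGenericIsHodgeGeneric` (HGQ, stmt-HodgeConjecture-11595), route `PeriodDeficiency`:
# the reduction of HGQ to Mumford–Tate-rank invariance + countability of special subvarieties

Sorry-free extract of the line skeleton `Cruxes/QbarGenericIsHodgeGeneric/Lines/birth.lean` (lead
reshapes r1–r4, 2026-08-17), part 1 of 2 (part 2: `…QbarGenericIsHodgeGenericCore`). HGQ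
(`Theses.PeriodDeficiency.QbarGenericIsHodgeGeneric`): every `s ∈ S(ℂ)` of a smooth projective
`ℚ̄`-family `f = f₀ ⊗_σ ℂ` over a smooth irreducible `ℚ̄`-scheme is Hodge-generic (`dim MT` maximal,
`VHSData.IsHodgeGenericIn`) in its `ℚ̄`-Zariski closure `W(s) = ⋂₀ {Z | IsDefinedOverQbar σ S₀ Z ∧ s ∈ Z}`.
PROVED HERE, unconditionally on the tree (using the landed stubs `stub_mtRankAt_bounded`,
`stub_irredClosed_hasMaximal`, `stub_conj_irredClosed`, `stub_countableOrbit_definedOverQbar`):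

* `exists_specialClosure` — every point has a SPECIAL CLOSURE: a special subvariety
  (`VHSData.IsSpecialSubvariety`, Baldi–Klingler–Ullmo 2024 Def. 3.3 / Lemma 3.6) `Y ∋ s` with
  `dim MT ≤ dim MT(s)` on `Y` (maximal irreducible Zariski-closed rank-bounding set through `s`;
  bounded ranks + ACC on irreducible closed subsets);
* `isSpecialSubvariety_image_conjPoint` — if the Mumford–Tate rank is `Aut(ℂ/ℚ̄)`-invariant, Galois
  conjugates of special subvarieties are special (Klingler–Otwinowska–Urbanik 2023 §1.2);
* `special_isDefinedOverQbar_of` — rank invariance + countability of the special subvarieties meeting an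
  affine chart ⟹ every special subvariety is defined over `ℚ̄` (countable Galois orbit ⟹ `ℚ̄`-defined,
  Weil 1946 / EGA IV₂ 4.8);
* `isHodgeGenericIn_qbarClosure_of_definedOverQbar` — the seam: a `ℚ̄`-defined rank-bounding `Y ∋ s`
  forces Hodge-genericity of `s` in `W(s) ⊆ Y`;
* `qbarGenericIsHodgeGeneric_of_rankInvariance_of_countable` — **HGQ ⟸ (rank invariance under
  `Aut(ℂ/ℚ̄)`) ∧ (countably many special subvarieties meet each affine chart)**;
* `mtRankAt_conjPoint_of_qbarGenericIsHodgeGeneric` — conversely HGQ ⟹ rank invariance (tightness).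

Part 2 instantiates the two hypotheses: countability = the named fact
`Motives.countable_specialSubvarieties_meeting_affineOpen` (Cattani–Deligne–Kaplan 1995 / BKU 2024 §3.4);
rank invariance ⟸ its family-free core "`dim MT(Hⁱ(X^τ)) = dim MT(Hⁱ(X))`" (open; Deligne's
absolute-Hodge territory), to which HGQ is thereby reduced and which HGQ implies back.

## References
* [KlinglerOtwinowskaUrbanik2023] Klingler–Otwinowska–Urbanik, Ann. Sci. ÉNS 56 (2023), §1.2, Conj. 1.5, Prop. 2.1.
* [BaldiKlinglerUllmo2024] Baldi–Klingler–Ullmo, Invent. Math. 235 (2024), §3.2, Def. 3.3, §3.4, Lemma 3.6.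
* [Voisin2007HodgeLoci] Voisin, Compositio 143 (2007), Thm. 0.5.
* [Lang1958IAG] Lang, Introduction to Algebraic Geometry (1958), Ch. III §4–§5.
* [EGAIV2] Grothendieck, EGA IV₂ §4.8.
-/

noncomputable section

-- every declaration of this problem lives in `Summit.HodgeConjecture.HodgeConjecture.…` (problem = summit)
set_option linter.dupNamespace false

namespace Summit.HodgeConjecture.HodgeConjecture.Theorems

open CategoryTheory AlgebraicGeometry
open Literature.AlgebraicGeometry.Motives Literature.AlgebraicGeometry.HodgeTheory
open Summit.HodgeConjecture.HodgeConjecture.Theses.PeriodDeficiency (QbarGenericIsHodgeGeneric)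

/-! ### A complex point is an irreducible Zariski-closed set of points -/

/-- **A complex point is an irreducible Zariski-closed set of points**: for `S` locally of finite
type over `ℂ` and `s ∈ S(ℂ)`, `{s}` is closed (it is `pt ⁻¹' {s.pt}`, `s.pt` being a closed point —
`ComplexPoints.isClosed_pt` — that determines `s`, `ComplexPoints.ext_of_pt_eq`) and irreducible (a singleton) for the Zariski topology on `S(ℂ)`. [folklore] -/
theorem singleton_isIrreducibleZariskiClosedOnPoints {S : SchemeOver ℂ} [LocallyOfFiniteType S.hom]
    (s : ComplexPoints S) : IsIrreducibleZariskiClosedOnPoints S ({s} : Set (ComplexPoints S)) := by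
  refine ⟨(isZariskiClosedOnPoints_iff_isClosed _).1 ⟨{s.pt}, ComplexPoints.isClosed_pt s, ?_⟩, ?_⟩
  · ext P
    simp only [Set.mem_singleton_iff, Set.mem_setOf_eq]
    exact ⟨fun h => h ▸ rfl, fun h => ComplexPoints.ext_of_pt_eq h⟩
  · have : zariskiSet S ({s} : Set (ComplexPoints S)) = {(show ZariskiPoints S ℂ from s)} := rfl
    rw [this]
    exact isIrreducible_singleton

/-- The complexification `S₀ ⊗_σ ℂ` of a smooth `ℚ̄`-scheme is locally of finite type over `ℂ`
(smooth ⟹ locally of finite presentation, stable under base change; Mathlib instances). [folklore] -/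
theorem locallyOfFiniteType_baseChangeHom {σ : AlgebraicClosure ℚ →+* ℂ}
    {S₀ : SchemeOver (AlgebraicClosure ℚ)} (hsm : AlgebraicGeometry.Smooth S₀.hom) :
    LocallyOfFiniteType ((baseChangeHom σ).obj S₀).hom := by
  haveI := hsm
  haveI : AlgebraicGeometry.Smooth ((baseChangeHom σ).obj S₀).hom :=
    inferInstanceAs (AlgebraicGeometry.Smooth
      (Limits.pullback.snd S₀.hom (Spec.map (CommRingCat.ofHom σ))))
  infer_instance

/-! ### The special closure of a point -/

/-- **The special closure of a point.** For `B` classical, `D` a geometric VHS datum of the smooth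
projective `ℚ̄`-family `f₀ ⊗_σ ℂ` over the smooth irreducible `S₀` and `s ∈ S(ℂ)`, there is a special
subvariety `Y ∋ s` (`VHSData.IsSpecialSubvariety`, BKU Def. 3.3 / Lemma 3.6) on which
`D.mtRankAt ≤ D.mtRankAt s`. Proof: `Y` := a maximal member (`stub_irredClosed_hasMaximal`) of
`{Y ∋ s | Y irreducible Zariski-closed, mtRankAt ≤ mtRankAt s on Y}` (non-empty: `{s}`); for an
irreducible closed `Z ⊋ Y`, maximality puts `Z` outside the family, giving `z ∈ Z` with
`mtRankAt z > mtRankAt s ≥ genericMTRank Y`, and `genericMTRank Z ≥ mtRankAt z` because the ranks are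
bounded (`stub_mtRankAt_bounded`). [cite: BaldiKlinglerUllmo2024, §3.2 and Lemma 3.6] -/
theorem exists_specialClosure (B : BettiHodgeData ℂ) (hB : B.IsClassical) [HodgeTensorFacts.{0, 0}]
    (σ : AlgebraicClosure ℚ →+* ℂ) ⦃𝒳₀ S₀ : SchemeOver (AlgebraicClosure ℚ)⦄ (f₀ : 𝒳₀ ⟶ S₀)
    (n i : ℕ) (D : GeometricVHSData B ((baseChangeHom σ).map f₀) n i)
    [∀ s, Module.Finite ℚ (D.V.fiber s)] (hirr : IrreducibleSpace S₀.left)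
    (hsm : AlgebraicGeometry.Smooth S₀.hom) (s : ComplexPoints ((baseChangeHom σ).obj S₀)) :
    ∃ Y : Set (ComplexPoints ((baseChangeHom σ).obj S₀)),
      s ∈ Y ∧ D.IsSpecialSubvariety Y ∧ ∀ y ∈ Y, D.mtRankAt y ≤ D.mtRankAt s := by
  haveI : LocallyOfFiniteType ((baseChangeHom σ).obj S₀).hom := locallyOfFiniteType_baseChangeHom hsm
  obtain ⟨C, hC⟩ := stub_mtRankAt_bounded B hB σ f₀ n i D hirr hsm
  -- the family of irreducible closed sets through `s` on which the rank is bounded by the rank at `s`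
  set F : Set (Set (ComplexPoints ((baseChangeHom σ).obj S₀))) :=
    {Y | s ∈ Y ∧ IsIrreducibleZariskiClosedOnPoints ((baseChangeHom σ).obj S₀) Y ∧
      ∀ y ∈ Y, D.mtRankAt y ≤ D.mtRankAt s} with hF
  have hsF : ({s} : Set _) ∈ F :=
    ⟨Set.mem_singleton s, singleton_isIrreducibleZariskiClosedOnPoints s,
      fun y hy => (congrArg D.mtRankAt (Set.mem_singleton_iff.mp hy)).le⟩
  obtain ⟨M, hMF, hMmax⟩ := stub_irredClosed_hasMaximal σ hirr hsm F ⟨{s}, hsF⟩ fun A hA => hA.2.1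
  refine ⟨M, hMF.1, ⟨hMF.2.1, fun Z hZ hMZ => ?_⟩, hMF.2.2⟩
  -- `Z ⊋ M` irreducible closed is not in `F`, so some point of `Z` has rank `> mtRankAt s`
  have hZF : Z ∉ F := fun hZF => hMZ.ne (hMmax Z hZF hMZ.le).symm
  have hz : ∃ z ∈ Z, D.mtRankAt s < D.mtRankAt z := by
    by_contra hcon
    push Not at hcon
    exact hZF ⟨hMZ.le hMF.1, hZ, hcon⟩
  obtain ⟨z, hzZ, hsz⟩ := hz
  -- bounded ranks: the generic rank of `Z` is at least the rank at `z`
  have hbdd : BddAbove (Set.range fun y : Z => D.mtRankAt y) :=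
    ⟨C, by rintro _ ⟨y, rfl⟩; exact hC y⟩
  have h1 : D.genericMTRank M ≤ D.mtRankAt s := by
    haveI : Nonempty M := ⟨⟨s, hMF.1⟩⟩
    exact ciSup_le fun y => hMF.2.2 y y.2
  have h2 : D.mtRankAt z ≤ D.genericMTRank Z := D.mtRankAt_le_genericMTRank hbdd hzZ
  omega

/-! ### Conjugates of special subvarieties are special; special ⟹ defined over `ℚ̄` -/

section GaloisOrbit

variable {σ : AlgebraicClosure ℚ →+* ℂ} {S₀ : SchemeOver (AlgebraicClosure ℚ)}

/-- `τ⁻¹ · (τ · A) = A` for a set of complex points. [folklore] -/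
theorem image_conjPoint_inv_image (τ : ringAutOver σ)
    (A : Set (ComplexPoints ((baseChangeHom σ).obj S₀))) :
    conjPoint σ S₀ τ⁻¹ '' (conjPoint σ S₀ τ '' A) = A := by
  rw [Set.image_image]
  convert Set.image_id A using 2
  exact conjPoint_inv_conjPoint σ S₀ τ _

variable [HodgeTensorFacts.{0, 0}] {m : ℤ}
  (D : VHSData (ComplexPoints ((baseChangeHom σ).obj S₀)) m) [∀ s, Module.Finite ℚ (D.V.fiber s)]

/-- **Rank invariance ⟹ generic Mumford–Tate ranks of conjugates agree**: if `D.mtRankAt` is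
invariant under `τ`, then `genericMTRank (τ · A) = genericMTRank A` (reindex the supremum along the
bijection `A ≃ τ · A`). [folklore] -/
theorem genericMTRank_image_conjPoint (τ : ringAutOver σ)
    (hτ : ∀ y, D.mtRankAt (conjPoint σ S₀ τ y) = D.mtRankAt y)
    (A : Set (ComplexPoints ((baseChangeHom σ).obj S₀))) :
    D.genericMTRank (conjPoint σ S₀ τ '' A) = D.genericMTRank A := by
  unfold VHSData.genericMTRank
  let e : A → ↥(conjPoint σ S₀ τ '' A) := fun x => ⟨conjPoint σ S₀ τ x, Set.mem_image_of_mem _ x.2⟩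
  have he : Function.Surjective e := by
    rintro ⟨_, x, hx, rfl⟩
    exact ⟨⟨x, hx⟩, rfl⟩
  rw [← he.iSup_comp]
  exact iSup_congr fun x => hτ x

/-- **Conjugates of special subvarieties are special** (given STUB (i) for `τ` and `τ⁻¹` and rank
invariance under `τ`): `τ · Y` is irreducible closed, `genericMTRank (τ · Y) = genericMTRank Y`, and an
irreducible closed `Z ⊋ τ · Y` gives `τ⁻¹ · Z ⊋ Y`, whence
`genericMTRank Z = genericMTRank (τ⁻¹ · Z) > genericMTRank Y`. This is the mechanism behind "the Hodge
conjecture implies that special subvarieties of `ℚ̄`-variations are defined over `ℚ̄`" (KOU §1.2).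
[cite: KlinglerOtwinowskaUrbanik2023, §1.2] -/
theorem isSpecialSubvariety_image_conjPoint (τ : ringAutOver σ)
    (hconj : ∀ (τ' : ringAutOver σ) (A : Set (ComplexPoints ((baseChangeHom σ).obj S₀))),
      IsIrreducibleZariskiClosedOnPoints ((baseChangeHom σ).obj S₀) A →
      IsIrreducibleZariskiClosedOnPoints ((baseChangeHom σ).obj S₀) (conjPoint σ S₀ τ' '' A))
    (hτ : ∀ (τ' : ringAutOver σ) y, D.mtRankAt (conjPoint σ S₀ τ' y) = D.mtRankAt y)
    {Y : Set (ComplexPoints ((baseChangeHom σ).obj S₀))} (hY : D.IsSpecialSubvariety Y) :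
    D.IsSpecialSubvariety (conjPoint σ S₀ τ '' Y) := by
  refine ⟨hconj τ Y hY.1, fun Z hZ hYZ => ?_⟩
  have h1 : Y ⊂ conjPoint σ S₀ τ⁻¹ '' Z := by
    simpa only [image_conjPoint_inv_image] using image_conjPoint_ssubset σ S₀ τ⁻¹ hYZ
  have h2 := hY.2 _ (hconj τ⁻¹ Z hZ) h1
  rwa [genericMTRank_image_conjPoint D τ⁻¹ (hτ τ⁻¹), ← genericMTRank_image_conjPoint D τ (hτ τ) Y]
    at h2

/-- **Special subvarieties are defined over `ℚ̄`, from the four r2 stubs** (as hypotheses on this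
`D`): the `Aut(ℂ/ℚ̄)`-orbit of a special `Y` consists of special subvarieties
(`isSpecialSubvariety_image_conjPoint`), a countable set, so the orbit is countable and the
countable-orbit descent applies. [cite: KlinglerOtwinowskaUrbanik2023, §1.2 and Conj. 1.5(a)] -/
theorem special_isDefinedOverQbar_of
    (hconj : ∀ (τ : ringAutOver σ) (A : Set (ComplexPoints ((baseChangeHom σ).obj S₀))),
      IsIrreducibleZariskiClosedOnPoints ((baseChangeHom σ).obj S₀) A →
      IsIrreducibleZariskiClosedOnPoints ((baseChangeHom σ).obj S₀) (conjPoint σ S₀ τ '' A))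
    (hτ : ∀ (τ : ringAutOver σ) y, D.mtRankAt (conjPoint σ S₀ τ y) = D.mtRankAt y)
    (hcount : ∀ U₀ : S₀.left.Opens, IsAffineOpen U₀ →
      {Y : Set (ComplexPoints ((baseChangeHom σ).obj S₀)) | D.IsSpecialSubvariety Y ∧
        ∃ y ∈ Y, (baseChangeHomFst σ S₀).base y.pt ∈ U₀}.Countable)
    (hdesc : ∀ Y : Set (ComplexPoints ((baseChangeHom σ).obj S₀)),
      IsIrreducibleZariskiClosedOnPoints ((baseChangeHom σ).obj S₀) Y →
      {Y' : Set (ComplexPoints ((baseChangeHom σ).obj S₀)) |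
          ∃ τ : ringAutOver σ, Y' = conjPoint σ S₀ τ '' Y}.Countable →
      IsDefinedOverQbar σ S₀ Y)
    {Y : Set (ComplexPoints ((baseChangeHom σ).obj S₀))} (hY : D.IsSpecialSubvariety Y) :
    IsDefinedOverQbar σ S₀ Y := by
  -- a point `y₀ ∈ Y` and an affine chart `U₀ ∋ π y₀` of `S₀`; every conjugate of `Y` meets `π⁻¹ U₀`
  obtain ⟨P, hP⟩ := hY.1.2.nonempty
  have hy₀ : P.val ∈ Y := hP
  obtain ⟨_, ⟨U₀, hU₀, rfl⟩, hyU, -⟩ := S₀.left.isBasis_affineOpens.exists_subset_of_mem_open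
    (Set.mem_univ ((baseChangeHomFst σ S₀).base P.val.pt)) isOpen_univ
  refine hdesc Y hY.1 ((hcount U₀ hU₀).mono ?_)
  rintro _ ⟨τ, rfl⟩
  exact ⟨isSpecialSubvariety_image_conjPoint D τ hconj hτ hY,
    conjPoint σ S₀ τ P.val, Set.mem_image_of_mem _ hy₀, by rwa [base_pt_conjPoint]⟩

end GaloisOrbit

/-! ### The seam -/

/-- **The seam of the line.** If `s` lies on a set `Y ⊆ S(ℂ)` defined over `ℚ̄` on which the
Mumford–Tate rank is bounded by its value at `s`, then `s` is Hodge-generic in its `ℚ̄`-Zariski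
closure `W(s) = ⋂₀ {Z | IsDefinedOverQbar σ S₀ Z ∧ s ∈ Z}`: indeed `W(s) ⊆ Y`, and `s ∈ W(s)`.
Pure order theory on the tree's carriers (no property of `D` is used). [folklore] -/
theorem isHodgeGenericIn_qbarClosure_of_definedOverQbar [HodgeTensorFacts.{0, 0}]
    {σ : AlgebraicClosure ℚ →+* ℂ} {S₀ : SchemeOver (AlgebraicClosure ℚ)} {m : ℤ}
    (D : VHSData (ComplexPoints ((baseChangeHom σ).obj S₀)) m)
    [∀ s, Module.Finite ℚ (D.V.fiber s)]
    {s : ComplexPoints ((baseChangeHom σ).obj S₀)} {Y : Set (ComplexPoints ((baseChangeHom σ).obj S₀))}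
    (hsY : s ∈ Y) (hY : IsDefinedOverQbar σ S₀ Y) (hle : ∀ y ∈ Y, D.mtRankAt y ≤ D.mtRankAt s) :
    D.IsHodgeGenericIn (⋂₀ {Z | IsDefinedOverQbar σ S₀ Z ∧ s ∈ Z}) s :=
  ⟨Set.mem_sInter.2 fun _ hZ => hZ.2, fun y hy => hle y (Set.mem_sInter.1 hy Y ⟨hY, hsY⟩)⟩


/-! ### HGQ from rank invariance and countability -/

/-- **HGQ ⟸ (Mumford–Tate rank invariant under `Aut(ℂ/ℚ̄)`) ∧ (special subvarieties meeting an
affine chart are countable).** The special closure `Y ∋ s` (`exists_specialClosure`) is defined over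
`ℚ̄` (`special_isDefinedOverQbar_of`, with `stub_conj_irredClosed` and
`stub_countableOrbit_definedOverQbar`), so `W(s) ⊆ Y` inherits the rank bound and `s` is Hodge-generic
in `W(s)` (`isHodgeGenericIn_qbarClosure_of_definedOverQbar`) — HGQ concluded BY NAME.
[cite: KlinglerOtwinowskaUrbanik2023, §1.2 and Conj. 1.5(a)] -/
theorem qbarGenericIsHodgeGeneric_of_rankInvariance_of_countable :
    (∀ (B : BettiHodgeData ℂ), B.IsClassical → ∀ [HodgeTensorFacts.{0, 0}]
      (σ : AlgebraicClosure ℚ →+* ℂ) ⦃𝒳₀ S₀ : SchemeOver (AlgebraicClosure ℚ)⦄ (f₀ : 𝒳₀ ⟶ S₀)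
      (n i : ℕ) (D : GeometricVHSData B ((baseChangeHom σ).map f₀) n i)
      [∀ s, Module.Finite ℚ (D.V.fiber s)],
      IrreducibleSpace S₀.left → AlgebraicGeometry.Smooth S₀.hom →
      ∀ (τ : ringAutOver σ) (y : ComplexPoints ((baseChangeHom σ).obj S₀)),
        D.mtRankAt (conjPoint σ S₀ τ y) = D.mtRankAt y) →
    (∀ (B : BettiHodgeData ℂ), B.IsClassical → ∀ [HodgeTensorFacts.{0, 0}]
      (σ : AlgebraicClosure ℚ →+* ℂ) ⦃𝒳₀ S₀ : SchemeOver (AlgebraicClosure ℚ)⦄ (f₀ : 𝒳₀ ⟶ S₀)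
      (n i : ℕ) (D : GeometricVHSData B ((baseChangeHom σ).map f₀) n i)
      [∀ s, Module.Finite ℚ (D.V.fiber s)],
      IrreducibleSpace S₀.left → AlgebraicGeometry.Smooth S₀.hom →
      ∀ U₀ : S₀.left.Opens, IsAffineOpen U₀ →
        {Y : Set (ComplexPoints ((baseChangeHom σ).obj S₀)) | D.IsSpecialSubvariety Y ∧
          ∃ y ∈ Y, (baseChangeHomFst σ S₀).base y.pt ∈ U₀}.Countable) →
    QbarGenericIsHodgeGeneric := by
  intro hrank hcount B hB _ σ 𝒳₀ S₀ f₀ n i D _ hirr hsm s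
  obtain ⟨Y, hsY, hYsp, hle⟩ := exists_specialClosure B hB σ f₀ n i D hirr hsm s
  have hYdef : IsDefinedOverQbar σ S₀ Y :=
    special_isDefinedOverQbar_of D.toVHSData (fun τ A => stub_conj_irredClosed σ τ A)
      (hrank B hB σ f₀ n i D hirr hsm) (hcount B hB σ f₀ n i D hirr hsm)
      (stub_countableOrbit_definedOverQbar σ hirr hsm) hYsp
  exact isHodgeGenericIn_qbarClosure_of_definedOverQbar D.toVHSData hsY hYdef hle

/-! ### Tightness: HGQ implies rank invariance -/

section Tightness

variable {σ : AlgebraicClosure ℚ →+* ℂ} {S₀ : SchemeOver (AlgebraicClosure ℚ)}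

/-- The automorphisms of `ℂ` over `σ(ℚ̄)` fix the algebraic numbers `algebraicClosure ℚ ℂ ⊆ ℂ`
pointwise (`σ(ℚ̄)` IS the field of algebraic numbers, `algebraicClosure_le_fieldRange`). [folklore] -/
theorem ringAutOver_apply_eq_self (τ : ringAutOver σ) :
    ∀ z ∈ (algebraicClosure ℚ ℂ).toSubfield, τ z = z := by
  intro z hz
  obtain ⟨w, rfl⟩ := algebraicClosure_le_fieldRange σ hz
  letI := σ.toAlgebra
  exact τ.commutes w

/-- **Conjugates of `y` lie in the `ℚ̄`-Zariski closure `W(y)`**: every `ℚ̄`-defined `Z ∋ y` is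
`Aut(ℂ/ℚ̄)`-stable, hence contains `τ · y`. [cite: Lang1958IAG, Ch. III §5, C4] -/
theorem conjPoint_mem_qbarClosure (τ : ringAutOver σ) (y : ComplexPoints ((baseChangeHom σ).obj S₀)) :
    conjPoint σ S₀ τ y ∈ ⋂₀ {Z | IsDefinedOverQbar σ S₀ Z ∧ y ∈ Z} :=
  Set.mem_sInter.2 fun _ hZ => hZ.1.2 τ (ringAutOver_apply_eq_self τ) (Set.mem_image_of_mem _ hZ.2)

variable [HodgeTensorFacts.{0, 0}] {m : ℤ}
  (D : VHSData (ComplexPoints ((baseChangeHom σ).obj S₀)) m) [∀ s, Module.Finite ℚ (D.V.fiber s)]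

/-- **HGQ ⟹ rank invariance** (for one `D`): if every point is Hodge-generic in its `ℚ̄`-Zariski
closure, then `D.mtRankAt` is `Aut(ℂ/ℚ̄)`-invariant — `τ · y ∈ W(y)` bounds `mtRankAt (τ · y)` by
`mtRankAt y`, and `y = τ⁻¹ · (τ · y) ∈ W(τ · y)` bounds the other way. So STUB (ii) is implied by the
crux: the reshape r2 isolates a NECESSARY condition (no strength is lost in (ii)). [folklore] -/
theorem mtRankAt_conjPoint_of_isHodgeGenericIn
    (hgen : ∀ s, D.IsHodgeGenericIn (⋂₀ {Z | IsDefinedOverQbar σ S₀ Z ∧ s ∈ Z}) s)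
    (τ : ringAutOver σ) (y : ComplexPoints ((baseChangeHom σ).obj S₀)) :
    D.mtRankAt (conjPoint σ S₀ τ y) = D.mtRankAt y := by
  refine le_antisymm ((hgen y).2 _ (conjPoint_mem_qbarClosure τ y)) ?_
  have h := (hgen (conjPoint σ S₀ τ y)).2 _ (conjPoint_mem_qbarClosure τ⁻¹ (conjPoint σ S₀ τ y))
  rwa [conjPoint_inv_conjPoint] at h

end Tightness

/-- **HGQ ⟹ Mumford–Tate rank invariance under `Aut(ℂ/ℚ̄)`** (`mtRankAt_conjPoint_of_isHodgeGenericIn`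
per datum): the hypothesis `hrank` of `qbarGenericIsHodgeGeneric_of_rankInvariance_of_countable` is a
NECESSARY condition. [folklore] -/
theorem mtRankAt_conjPoint_of_qbarGenericIsHodgeGeneric (h : QbarGenericIsHodgeGeneric) :
    ∀ (B : BettiHodgeData ℂ), B.IsClassical → ∀ [HodgeTensorFacts.{0, 0}]
      (σ : AlgebraicClosure ℚ →+* ℂ) ⦃𝒳₀ S₀ : SchemeOver (AlgebraicClosure ℚ)⦄ (f₀ : 𝒳₀ ⟶ S₀)
      (n i : ℕ) (D : GeometricVHSData B ((baseChangeHom σ).map f₀) n i)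
      [∀ s, Module.Finite ℚ (D.V.fiber s)],
      IrreducibleSpace S₀.left → AlgebraicGeometry.Smooth S₀.hom →
      ∀ (τ : ringAutOver σ) (y : ComplexPoints ((baseChangeHom σ).obj S₀)),
        D.mtRankAt (conjPoint σ S₀ τ y) = D.mtRankAt y :=
  fun B hB _ σ _ _ f₀ n i D _ hirr hsm τ y =>
    mtRankAt_conjPoint_of_isHodgeGenericIn D.toVHSData (h B hB σ f₀ n i D hirr hsm) τ y

end Summit.HodgeConjecture.HodgeConjecture.Theorems

end
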